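import Summits.RiemannHypothesis.RiemannHypothesis.Theorems.TiltedLandingLaw421R3Lens1ToothDichotomy

/-! # TiltedLandingLaw421 — lens-1 (N″c) «ToothDispatch» IMAGE v1: law (a′) `ToothDichotomyQ θ` dispatched into 2′'s near-tooth sub-case (NT fold)

W-09 lens-1 (rh33346-lens-1 g10). IMAGE v1 of SKETCH v2 285875e938d4a75c (director-rh g30 (CA1021)(3) «after #124 lands, next object = the
dispatcher from `ToothDichotomyQ θ` into `RegUmbrellaLowS θ`'s near-tooth sub-case with the `NoTallerToucher` fold»; WORD (CA1043)(1) = freeze as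
image, token 129; statements and proofs of the sketch VERBATIM except the rename `near_or_far` ↦ `umbrellaLowNT_near_or_far`, this docblock new).
ONE import = TREE #1275 `…Theorems.TiltedLandingLaw421R3Lens1ToothDichotomy` (lens-1's 124 v2: law (a′) `ToothDichotomyQ θ` with the umbrella
datum's `¬ StTrkDQ … j b` / `PinnedTopAt f j b` binders, the stronger `ToothOnlyDichotomyQ`, `toothDichotomyQ_of_toothOnly`,
`succ_of_umbrellaLowNT_nearTooth`), which carries #1271/#1264/#1262. Namespace `RhW08.Lens1ToothNestUmbrella` reopened. SUPPORT (K-only): no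
`sorry`, NO new law — 5 defs (a tooth predicate, the near/far split of the NT low umbrella, the two residuals of 2′ in successor currency with the
binders #0–#13 of `RegUmbrellaLowS θ` (tree #1256 :115–:123) VERBATIM) and 6 (K) theorems. No stub is closed by this file; COUNT unmoved; registry
v14q′ untouched.

DECL-HOME RULE (CA1043)(1), binding: `NearToothAt`, `UmbrellaLowNTNear θ` / `UmbrellaLowNTFar θ`, `RegUmbrellaLowNTNearS θ` / `RegUmbrellaLowNTFarS
θ` LIVE IN THIS FILE; tenure's drawer decls `UmbrellaLowNT θ` / `RegUmbrellaLowNTS θ` (e89d23af, NOT tree) are NOT declared here (the NT umbrella is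
spelled out as `∃ T b, …` at every use) — if a registry fold ever needs them in the tree they are stated as `Near ∨ Far` over these decls or cite
them, never re-spelled; so no alpha-twin either way.

HONEST SIZING (accepted (CA1043)(1), and the point of the file): it moves NO difficulty, it TYPES THE SEAM — near-tooth species ⇐ law (a′)
`ToothDichotomyQ (1/10)` (or the stronger `ToothOnlyDichotomyQ`), both OPEN S-typed sentences asserted by nothing; far/no-tooth residual =
`RegUmbrellaLowNTFarS (1/10)` (OPEN; 119's `umbrella_dispatch` branches (ii)/(iii) and (iii) `UmbrellaDichotomyQ θ κ₁`'s RV part live there) — so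
NEG-hunters and certificate work address DISJOINT species by name. A registry re-cut of 2′ along this seam is a LATER decision (only if one side
closes).

* §D1 `NearToothAt f j T` («∃ t : ℝ, f⁽ʲ⁾ t = 0 ∧ |t − Re T| ≤ Im T/2», the tooth clause of 112/119/124), `UmbrellaLowNTNear θ …` /
  `UmbrellaLowNTFar θ …` (the NT low umbrella's conjuncts — tree `UmbrellaLow θ` #1256 :108 plus `NoTallerToucher f j T` on the tallest band state
  `T`, = tenure's drawer `UmbrellaLowNT θ` :34 — VERBATIM, ∧ `NearToothAt f j T` resp. `¬ NearToothAt f j T` for the SAME witness `T`),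
  `umbrellaLowNT_near_or_far` (excluded middle).
* §D2 `RegUmbrellaLowNTNearS θ`, ★ `RegUmbrellaLowNTFarS θ` (binders #0–#13 of 2′ verbatim + the near / far datum ⊢ `∃ u, StTrkDQ … (j+1) u`; the
  far one is the typed OPEN residual that law (a′) leaves of 2′-NT).
* §D3 ★★ `regUmbrellaLowNTNearS_of_toothDichotomy : ToothDichotomyQ θ → RegUmbrellaLowNTNearS θ` (THE DISPATCHER; consumes the frame, #2 `¬ ReadyR2
  … j v` and the umbrella datum incl. `¬ StTrkDQ … j b` / `PinnedTopAt f j b` through #1275's `succ_of_umbrellaLowNT_nearTooth`; binders #1, #3–#13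
  are 2′'s scope, unused), `regUmbrellaLowNTNearS_of_toothOnly` (the same from `ToothOnlyDichotomyQ` via `toothDichotomyQ_of_toothOnly`),
  `succ_of_near_far` (binder-level composition: near + far residuals ⇒ the successor from an NT low umbrella spelled out under 2′'s binders —
  tenure's `RegUmbrellaLowNTS θ` :47 would follow by `intro …; exact succ_of_near_far …`), ★★ `succ_of_toothDichotomy_far` (law (a′) + far residual
  ⇒ the same), `regUmbrellaLowNTFarS_of_lowS : RegUmbrellaLowS θ → RegUmbrellaLowNTFarS θ` (the far residual is WEAKER than 2′ as registered: forget
  NT and the far datum).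

HONEST LABEL: every theorem here is K bookkeeping over typed OPEN sentences; nothing here bears on the truth of RH; RH is not proved;
⟨33346⟩/⟨33347⟩ OPEN; stubs 1′/2/2′/3 OPEN; typed ≠ checked ≠ landed ≠ proved. -/

noncomputable section

open Complex Set
open scoped ComplexConjugate

namespace RhW08.Lens1ToothNestUmbrella

open RhIdea6.G17.W07C7 RhIdea6.G17.W07C7.Rev6 RhIdea6.G18.W07C8.Law421BirthS RhIdea6.G19.W07C11.Seam
open RhW08.Round1 RhW08.StSwap RhW08.Round2 RhW08.QuadW RhW08.SuccB RhW08.SuccSplit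
open RhW08.Lens1Pinning (NoTallerToucher)
open RhIdea6.G20.W07C12.Frac RhIdea6.G20.W07C12.StColP RhW07.C12.FieldSplit RhIdea6.G21.W07C13.TentMax
open RhW07.C14.TwoSided RhW07.C14.Classes RhW07.C14.Lineage RhW07.C14.Booking
open RhW07.C13.Heredity RhIdea6.G22.W07C15pre.Injection RhW07.E3.Cell RhW07.E3.Lit
open RhW08.SealSwapQ RhW08.SealSwap RhW08.SuccTheft RhW08.Column RhW08.Hurwitz RhW08.ClusterQ RhW08.ClusterQM
open RhW08.NewtonDoor RhW08.NewtonDoorGenusOne RhW08.PurseP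
open RhW08.Lens1SignCut RhW08.Lens1Pinning RhW08.Lens1PinningTol
open RhW08.Lens1Coverage (CellF CellNb LandingDipDeep LandingDipW IsolatedNewtonL)
open RhW08.Lens1TopChild (PinnedTopAt)

/-! ## §D1 The near-tooth / far-tooth split of the NT low umbrella (v14q″ fold: the tallest band state `T` carries `NoTallerToucher`) -/

/-- A NEAR TOOTH under `T` at level `j`: a real zero `t` of `f⁽ʲ⁾` with `|t − Re T| ≤ Im T/2` (the tooth clause of 112/119/124). -/
def NearToothAt (f : ℂ → ℂ) (j : ℕ) (T : ℂ) : Prop :=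
  ∃ t : ℝ, iteratedDeriv j f (t : ℂ) = 0 ∧ |t - T.re| ≤ T.im / 2

/-- NT low umbrella WITH a near tooth under its top: the conjuncts of tenure's drawer `UmbrellaLowNT θ` (= tree `UmbrellaLow θ` #1256 :108 with
`NoTallerToucher f j T` on the tallest band state) VERBATIM, plus `NearToothAt f j T` for the SAME witness `T`. -/
def UmbrellaLowNTNear (θ : ℝ) (η : ℝ) (f : ℂ → ℂ) (x₀ s hmax R Hs : ℝ) (B : ℕ) (j : ℕ) : Prop :=
  ∃ T b : ℂ, StTrkDQ η f x₀ s hmax R Hs B j T ∧ (∀ w : ℂ, StTrkDQ η f x₀ s hmax R Hs B j w → w.im ≤ T.im) ∧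
    NoTallerToucher f j T ∧
    iteratedDeriv j f b = 0 ∧ (1 - θ) * T.im ≤ b.im ∧ b.im ≤ T.im ∧ |T.re - b.re| ≤ T.im + b.im ∧
    ¬ StTrkDQ η f x₀ s hmax R Hs B j b ∧ PinnedTopAt f j b ∧ NearToothAt f j T

/-- NT low umbrella with NO near tooth under its top (same conjuncts, `¬ NearToothAt f j T`). -/
def UmbrellaLowNTFar (θ : ℝ) (η : ℝ) (f : ℂ → ℂ) (x₀ s hmax R Hs : ℝ) (B : ℕ) (j : ℕ) : Prop :=
  ∃ T b : ℂ, StTrkDQ η f x₀ s hmax R Hs B j T ∧ (∀ w : ℂ, StTrkDQ η f x₀ s hmax R Hs B j w → w.im ≤ T.im) ∧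
    NoTallerToucher f j T ∧
    iteratedDeriv j f b = 0 ∧ (1 - θ) * T.im ≤ b.im ∧ b.im ≤ T.im ∧ |T.re - b.re| ≤ T.im + b.im ∧
    ¬ StTrkDQ η f x₀ s hmax R Hs B j b ∧ PinnedTopAt f j b ∧ ¬ NearToothAt f j T

/-- (K) SPLIT: an NT low umbrella (tenure's `UmbrellaLowNT θ`, spelled out) is near-toothed or far-toothed — excluded middle on
`NearToothAt f j T` for its own witnesses `T, b`. -/
theorem umbrellaLowNT_near_or_far {θ η : ℝ} {f : ℂ → ℂ} {x₀ s hmax R Hs : ℝ} {B j : ℕ}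
    (hU : ∃ T b : ℂ, StTrkDQ η f x₀ s hmax R Hs B j T ∧ (∀ w : ℂ, StTrkDQ η f x₀ s hmax R Hs B j w → w.im ≤ T.im) ∧
      NoTallerToucher f j T ∧
      iteratedDeriv j f b = 0 ∧ (1 - θ) * T.im ≤ b.im ∧ b.im ≤ T.im ∧ |T.re - b.re| ≤ T.im + b.im ∧
      ¬ StTrkDQ η f x₀ s hmax R Hs B j b ∧ PinnedTopAt f j b) :
    UmbrellaLowNTNear θ η f x₀ s hmax R Hs B j ∨ UmbrellaLowNTFar θ η f x₀ s hmax R Hs B j := by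
  obtain ⟨T, b, hT, htall, hNT, hb0, hb1, hb2, htouch, hnb, hpin⟩ := hU
  by_cases h : NearToothAt f j T
  · exact Or.inl ⟨T, b, hT, htall, hNT, hb0, hb1, hb2, htouch, hnb, hpin, h⟩
  · exact Or.inr ⟨T, b, hT, htall, hNT, hb0, hb1, hb2, htouch, hnb, hpin, h⟩

/-! ## §D2 The two residuals in successor currency (binders #0–#13 of `RegUmbrellaLowS θ`, tree #1256 :115–:123, VERBATIM) -/

/-- NEAR-TOOTH residual of 2′ (NT form): binders of `RegUmbrellaLowS θ` verbatim, umbrella datum `UmbrellaLowNTNear θ`. Implied by law (a′) (tree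
#1275) via the dispatcher below; OPEN as a sentence (asserted by nothing). -/
def RegUmbrellaLowNTNearS (θ : ℝ) : Prop :=
  ∀ (η : ℝ) (f : ℂ → ℂ) (x₀ s hmax R Hs : ℝ) (B : ℕ), EngineHyps5 2 η f x₀ s hmax R Hs B → ∀ (j : ℕ) (v : ℂ),
    IsLowest StTrkDQ η f x₀ s hmax R Hs B j v → ¬ ReadyR2 η f x₀ s hmax R Hs B j v →
    ¬ AllInBandInRangeWindow f x₀ R Hs j v → ¬ Dimple f j v → DiscOverlap f j v →
    iteratedDeriv (j + 1) f v ≠ 0 →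
    ¬ CellF f j v → ¬ CellNb f x₀ R Hs j v → ¬ LandingDipDeep f x₀ R Hs j v → ¬ LandingDipW f x₀ R Hs j v →
    ¬ IsolatedNewtonL f x₀ R Hs j v → ¬ HungBox f x₀ R Hs j → (∃ i : ℕ, i ≤ j ∧ ¬ ColumnCuttable f x₀ R Hs i) →
    UmbrellaLowNTNear θ η f x₀ s hmax R Hs B j →
    ∃ u : ℂ, StTrkDQ η f x₀ s hmax R Hs B (j + 1) u

/-- ★ FAR-TOOTH residual of 2′ (NT form) — the TYPED OPEN RESIDUAL left by law (a): same binders, umbrella datum `UmbrellaLowNTFar θ`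
(no real zero of `f⁽ʲ⁾` within `Im T/2` of `Re T`). -/
def RegUmbrellaLowNTFarS (θ : ℝ) : Prop :=
  ∀ (η : ℝ) (f : ℂ → ℂ) (x₀ s hmax R Hs : ℝ) (B : ℕ), EngineHyps5 2 η f x₀ s hmax R Hs B → ∀ (j : ℕ) (v : ℂ),
    IsLowest StTrkDQ η f x₀ s hmax R Hs B j v → ¬ ReadyR2 η f x₀ s hmax R Hs B j v →
    ¬ AllInBandInRangeWindow f x₀ R Hs j v → ¬ Dimple f j v → DiscOverlap f j v →
    iteratedDeriv (j + 1) f v ≠ 0 →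
    ¬ CellF f j v → ¬ CellNb f x₀ R Hs j v → ¬ LandingDipDeep f x₀ R Hs j v → ¬ LandingDipW f x₀ R Hs j v →
    ¬ IsolatedNewtonL f x₀ R Hs j v → ¬ HungBox f x₀ R Hs j → (∃ i : ℕ, i ≤ j ∧ ¬ ColumnCuttable f x₀ R Hs i) →
    UmbrellaLowNTFar θ η f x₀ s hmax R Hs B j →
    ∃ u : ℂ, StTrkDQ η f x₀ s hmax R Hs B (j + 1) u

/-! ## §D3 The dispatcher from law (a) `ToothDichotomyQ θ` and the binder-level composition -/

/-- ★★ DISPATCHER: law (a) `ToothDichotomyQ θ` CLOSES the near-tooth residual (only the frame, #2 `¬ReadyR2` and the umbrella datum are consumed;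
kernel step = `succ_of_umbrellaLowNT_nearTooth`, tree 124). -/
theorem regUmbrellaLowNTNearS_of_toothDichotomy {θ : ℝ} (hN : ToothDichotomyQ θ) : RegUmbrellaLowNTNearS θ := by
  intro η f x₀ s hmax R Hs B hE j v _ hnR _ _ _ _ _ _ _ _ _ _ _ hU
  obtain ⟨T, b, hT, htall, hNT, hb0, hb1, hb2, htouch, hnb, hpin, hnear⟩ := hU
  exact succ_of_umbrellaLowNT_nearTooth hN hE hnR ⟨T, b, hT, htall, hNT, hb0, hb1, hb2, htouch, hnb, hpin, hnear⟩

/-- ★★ the same read from the STRONGER tooth-only conjecture (via `toothDichotomyQ_of_toothOnly`). -/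
theorem regUmbrellaLowNTNearS_of_toothOnly (hN : ToothOnlyDichotomyQ) (θ : ℝ) : RegUmbrellaLowNTNearS θ :=
  regUmbrellaLowNTNearS_of_toothDichotomy (toothDichotomyQ_of_toothOnly hN θ)

/-- (K) COMPOSITION at binder level: the near residual and the far residual together give the successor from an NT low umbrella (spelled out) under
the binders of 2′ — i.e. tenure's `RegUmbrellaLowNTS θ` (drawer e89d23af :47) follows by `intro …; exact succ_of_near_far …`. -/
theorem succ_of_near_far {θ : ℝ} (hNe : RegUmbrellaLowNTNearS θ) (hFa : RegUmbrellaLowNTFarS θ)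
    {η : ℝ} {f : ℂ → ℂ} {x₀ s hmax R Hs : ℝ} {B : ℕ} (hE : EngineHyps5 2 η f x₀ s hmax R Hs B) {j : ℕ} {v : ℂ}
    (hlow : IsLowest StTrkDQ η f x₀ s hmax R Hs B j v) (hnR : ¬ ReadyR2 η f x₀ s hmax R Hs B j v)
    (hwin : ¬ AllInBandInRangeWindow f x₀ R Hs j v) (hdim : ¬ Dimple f j v) (hov : DiscOverlap f j v)
    (hz : iteratedDeriv (j + 1) f v ≠ 0)
    (hnF : ¬ CellF f j v) (hnNb : ¬ CellNb f x₀ R Hs j v) (hnD : ¬ LandingDipDeep f x₀ R Hs j v) (hnW : ¬ LandingDipW f x₀ R Hs j v)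
    (hnI : ¬ IsolatedNewtonL f x₀ R Hs j v) (hB : ¬ HungBox f x₀ R Hs j) (hcut : ∃ i : ℕ, i ≤ j ∧ ¬ ColumnCuttable f x₀ R Hs i)
    (hU : ∃ T b : ℂ, StTrkDQ η f x₀ s hmax R Hs B j T ∧ (∀ w : ℂ, StTrkDQ η f x₀ s hmax R Hs B j w → w.im ≤ T.im) ∧
      NoTallerToucher f j T ∧
      iteratedDeriv j f b = 0 ∧ (1 - θ) * T.im ≤ b.im ∧ b.im ≤ T.im ∧ |T.re - b.re| ≤ T.im + b.im ∧
      ¬ StTrkDQ η f x₀ s hmax R Hs B j b ∧ PinnedTopAt f j b) :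
    ∃ u : ℂ, StTrkDQ η f x₀ s hmax R Hs B (j + 1) u := by
  rcases umbrellaLowNT_near_or_far (θ := θ) hU with hNear | hFar
  · exact hNe η f x₀ s hmax R Hs B hE j v hlow hnR hwin hdim hov hz hnF hnNb hnD hnW hnI hB hcut hNear
  · exact hFa η f x₀ s hmax R Hs B hE j v hlow hnR hwin hdim hov hz hnF hnNb hnD hnW hnI hB hcut hFar

/-- ★★ Hence, with law (a′) in hand, the FAR-TOOTH residual alone carries the NT form of 2′:
`ToothDichotomyQ θ → RegUmbrellaLowNTFarS θ → (2′-NT, spelled out)`. -/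
theorem succ_of_toothDichotomy_far {θ : ℝ} (hN : ToothDichotomyQ θ) (hFa : RegUmbrellaLowNTFarS θ)
    {η : ℝ} {f : ℂ → ℂ} {x₀ s hmax R Hs : ℝ} {B : ℕ} (hE : EngineHyps5 2 η f x₀ s hmax R Hs B) {j : ℕ} {v : ℂ}
    (hlow : IsLowest StTrkDQ η f x₀ s hmax R Hs B j v) (hnR : ¬ ReadyR2 η f x₀ s hmax R Hs B j v)
    (hwin : ¬ AllInBandInRangeWindow f x₀ R Hs j v) (hdim : ¬ Dimple f j v) (hov : DiscOverlap f j v)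
    (hz : iteratedDeriv (j + 1) f v ≠ 0)
    (hnF : ¬ CellF f j v) (hnNb : ¬ CellNb f x₀ R Hs j v) (hnD : ¬ LandingDipDeep f x₀ R Hs j v) (hnW : ¬ LandingDipW f x₀ R Hs j v)
    (hnI : ¬ IsolatedNewtonL f x₀ R Hs j v) (hB : ¬ HungBox f x₀ R Hs j) (hcut : ∃ i : ℕ, i ≤ j ∧ ¬ ColumnCuttable f x₀ R Hs i)
    (hU : ∃ T b : ℂ, StTrkDQ η f x₀ s hmax R Hs B j T ∧ (∀ w : ℂ, StTrkDQ η f x₀ s hmax R Hs B j w → w.im ≤ T.im) ∧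
      NoTallerToucher f j T ∧
      iteratedDeriv j f b = 0 ∧ (1 - θ) * T.im ≤ b.im ∧ b.im ≤ T.im ∧ |T.re - b.re| ≤ T.im + b.im ∧
      ¬ StTrkDQ η f x₀ s hmax R Hs B j b ∧ PinnedTopAt f j b) :
    ∃ u : ℂ, StTrkDQ η f x₀ s hmax R Hs B (j + 1) u :=
  succ_of_near_far (regUmbrellaLowNTNearS_of_toothDichotomy hN) hFa hE hlow hnR hwin hdim hov hz hnF hnNb hnD hnW hnI hB hcut hU

/-- (K) Conversely the far residual is WEAKER than 2′ as registered: `RegUmbrellaLowS θ → RegUmbrellaLowNTFarS θ` (forget NT and the tooth clause;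
`UmbrellaLow` is tree #1256 :108). -/
theorem regUmbrellaLowNTFarS_of_lowS {θ : ℝ} (h : RegUmbrellaLowS θ) : RegUmbrellaLowNTFarS θ := by
  intro η f x₀ s hmax R Hs B hE j v hlow hnR hwin hdim hov hz hnF hnNb hnD hnW hnI hB hcut hU
  obtain ⟨T, b, hT, htall, -, hb0, hb1, hb2, htouch, hnb, hpin, -⟩ := hU
  exact h η f x₀ s hmax R Hs B hE j v hlow hnR hwin hdim hov hz hnF hnNb hnD hnW hnI hB hcut ⟨T, b, hT, htall, hb0, hb1, hb2, htouch, hnb, hpin⟩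

end RhW08.Lens1ToothNestUmbrella
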